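import Summits.Parity.BatemanHorn.Theorems.AlmostPrimeZerosDiscMajorantLogFixedDiscXAdd
import HarnessLib

/-!
# Crux `DiscMajorantLog` (stmt-Parity-17114), line `Sketch`: the cell `k = 1`, `f = X + c`
(every monic degree-1 system) on the GROWING disc, from the wide `f = X` cell

Support lemma for the crux `Summit.Parity.BatemanHorn.Theses.AlmostPrimeZeros.DiscMajorantLog`
(line `Sketch`), stub `stub_growingDiscXAddOfWide`.  The hypothesis is the `f = (X)` cell on the
WIDER growing disc `‖z − 1‖ ≤ 3 log log y + 3`:
`‖P_y(z)‖ ≤ A·y·(log y)^{Re z − 1}·exp(C‖z−1‖ log(‖z−1‖+2))`, `P_y(z) := Σ_{0≤m≤y} z^{s(m)}`,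
`s(m) = Σ_{p^v ∥ m} min(v,2)`, for `y ≥ x₁`.  This file transports it to every monic linear system
`f = (X + c)`, `c : ℤ`, on the disc `‖z − 1‖ ≤ 3 log log x`, by the bookkeeping of the fixed-disc
file `AlmostPrimeZerosDiscMajorantLogFixedDiscXAdd` (lemmas `exponent_XAdd`, `sum_shift_natCast`,
`sum_shift_neg`, `norm_sum_pow_le`, `norm_le_of_mem_disc`, `re_sub_one_mem`, used BY NAME):

* for `c = d ≥ 0`: `S_x(z) = P_{x+d}(z) − Σ_{m<d} z^{s(m)}`;
* for `c = −d ≤ 0`: `S_x(z) = d + P_{x−d}(z)`.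

What changes on the growing disc (`ℓ := log log x`, radius `3ℓ`, `t = Re z − 1 ∈ [−(3ℓ+1), 3ℓ+1]`):
the disc at `x` sits inside the wide disc at `y = x ± d` because
`log log x − log log(x − d) ≤ d/((x−d) log(x−d)) ≤ 1`; the comparison `(log y)^t ≤ e·(log x)^t` holds as
soon as `|log log y − log log x|·|t| ≤ 1`, which follows from the same difference bound and
`|t| ≤ 3ℓ + 1 ≤ 4 log x` once `x ≥ 9d + 4`; and the boundary terms
`Σ_{m<d} ‖z‖^{s(m)} ≤ d (3ℓ+1)^{S}` (`S = max_{m<d} s(m)`) resp. `d` are absorbed by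
`x (log x)^t ≥ x (log x)^{−(3ℓ+1)} = exp(e^ℓ − 3ℓ² − ℓ)` for `ℓ ≥ 6(d + 3S + 4)` (`e^ℓ ≥ ℓ³/6`).
Reference for the cell itself: H. L. Montgomery, R. C. Vaughan, *Multiplicative Number Theory I*,
CUP 2007, §7.4 (Theorems 7.17–7.18).
-/

noncomputable section

namespace Summit.Parity.BatemanHorn.Cruxes.DiscMajorantLog.Sketch

open Polynomial Finset
open Literature.NumberTheory.Transcendental.LWMeasure (one_le_log_of_three_le)

namespace GrowingDiscXAdd

open FixedDiscXAdd

/-- `(log u − log v)·v ≤ u − v` for `0 < v ≤ u` (from `log(u/v) ≤ u/v − 1`). [folklore] -/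
theorem log_sub_mul_le {u v : ℝ} (hv : 0 < v) (hvu : v ≤ u) :
    (Real.log u - Real.log v) * v ≤ u - v := by
  have hu : 0 < u := hv.trans_le hvu
  have h := Real.log_le_sub_one_of_pos (div_pos hu hv)
  rw [Real.log_div hu.ne' hv.ne'] at h
  have e : (u / v - 1) * v = u - v := by
    rw [sub_mul, one_mul, div_mul_cancel₀ u hv.ne']
  calc (Real.log u - Real.log v) * v ≤ (u / v - 1) * v := mul_le_mul_of_nonneg_right h hv.le
    _ = u - v := e

/-- Iterated: `(log log a − log log b)·(b log b) ≤ a − b` for `1 < b ≤ a`. [folklore] -/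
theorem loglog_sub_mul_le {a b : ℝ} (hb : 1 < b) (hab : b ≤ a) :
    (Real.log (Real.log a) - Real.log (Real.log b)) * (b * Real.log b) ≤ a - b := by
  have hb0 : 0 < b := one_pos.trans hb
  have hlb : 0 < Real.log b := Real.log_pos hb
  have h1 := log_sub_mul_le hlb (Real.log_le_log hb0 hab)
  have h2 := log_sub_mul_le hb0 hab
  calc (Real.log (Real.log a) - Real.log (Real.log b)) * (b * Real.log b)
      = (Real.log (Real.log a) - Real.log (Real.log b)) * Real.log b * b := by ring
    _ ≤ (Real.log a - Real.log b) * b := mul_le_mul_of_nonneg_right h1 hb0.le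
    _ ≤ a - b := h2

/-- Two-sided `rpow` comparison on a growing range of exponents: if `L, L' > 0` and
`(log L' − log L)·t ≤ 1` then `L'^t ≤ e·L^t`. [folklore] -/
theorem rpow_le_exp_mul_rpow {L L' t : ℝ} (hL : 0 < L) (hL' : 0 < L')
    (h : (Real.log L' - Real.log L) * t ≤ 1) : L' ^ t ≤ Real.exp 1 * L ^ t := by
  rw [Real.rpow_def_of_pos hL', Real.rpow_def_of_pos hL, ← Real.exp_add, Real.exp_le_exp]
  linarith

/-- Monotonicity of the budget `A·y·(log y)^{Re z−1}·exp(C‖z−1‖ log(‖z−1‖+2))` in `A ≤ A'`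
(`A' ≥ 0`) and `C ≤ C'`. [folklore] -/
theorem budget_mono {A A' C C' : ℝ} (hA : A ≤ A') (hA' : 0 ≤ A') (hC : C ≤ C') (y : ℕ) (z : ℂ) :
    A * (y : ℝ) * Real.log (y : ℝ) ^ (z.re - 1) * Real.exp (C * ‖z - 1‖ * Real.log (‖z - 1‖ + 2)) ≤
      A' * (y : ℝ) * Real.log (y : ℝ) ^ (z.re - 1) *
        Real.exp (C' * ‖z - 1‖ * Real.log (‖z - 1‖ + 2)) := by
  have h1 : 0 ≤ (y : ℝ) * Real.log (y : ℝ) ^ (z.re - 1) :=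
    mul_nonneg (Nat.cast_nonneg _) (Real.rpow_nonneg (Real.log_natCast_nonneg y) _)
  have h2 : 0 ≤ ‖z - 1‖ * Real.log (‖z - 1‖ + 2) :=
    mul_nonneg (norm_nonneg _) (Real.log_nonneg (by linarith [norm_nonneg (z - 1)]))
  have h3 : Real.exp (C * ‖z - 1‖ * Real.log (‖z - 1‖ + 2)) ≤
      Real.exp (C' * ‖z - 1‖ * Real.log (‖z - 1‖ + 2)) := by
    rw [Real.exp_le_exp, mul_assoc, mul_assoc]
    exact mul_le_mul_of_nonneg_right hC h2
  calc A * y * Real.log (y : ℝ) ^ (z.re - 1) * Real.exp (C * ‖z - 1‖ * Real.log (‖z - 1‖ + 2))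
      = A * (y * Real.log (y : ℝ) ^ (z.re - 1)) *
          Real.exp (C * ‖z - 1‖ * Real.log (‖z - 1‖ + 2)) := by ring
    _ ≤ A' * (y * Real.log (y : ℝ) ^ (z.re - 1)) *
          Real.exp (C' * ‖z - 1‖ * Real.log (‖z - 1‖ + 2)) :=
        mul_le_mul (mul_le_mul_of_nonneg_right hA h1) h3 (Real.exp_pos _).le (mul_nonneg hA' h1)
    _ = _ := by ring

/-- Absorbing the boundary terms on the growing disc: for every `D` and `S : ℕ` there is `x₂` with
`D (3ℓ + 1)^S ≤ x (log x)^t` for all `x ≥ x₂` and all `t ≥ −(3ℓ + 1)`, `ℓ = log log x`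
(take logs: `|D| + 3Sℓ + 3ℓ² + ℓ ≤ (|D| + 3S + 4)ℓ² ≤ ℓ³/6 ≤ e^ℓ` for `ℓ ≥ 6(|D| + 3S + 4)`).
[folklore] -/
theorem junk_absorb (D : ℝ) (S : ℕ) : ∃ x₂ : ℕ, ∀ x : ℕ, x₂ ≤ x → ∀ t : ℝ,
    -(3 * Real.log (Real.log (x : ℝ)) + 1) ≤ t →
      D * (3 * Real.log (Real.log (x : ℝ)) + 1) ^ S ≤ (x : ℝ) * Real.log (x : ℝ) ^ t := by
  set K : ℝ := |D| + 3 * S + 4 with hK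
  refine ⟨⌈Real.exp (Real.exp (6 * K))⌉₊, fun x hx t ht => ?_⟩
  have h1 : Real.exp (Real.exp (6 * K)) ≤ x := (Nat.le_ceil _).trans (by exact_mod_cast hx)
  have hx0 : (0 : ℝ) < x := (Real.exp_pos _).trans_le h1
  have hL : Real.exp (6 * K) ≤ Real.log (x : ℝ) := by rwa [Real.le_log_iff_exp_le hx0]
  have hL0 : 0 < Real.log (x : ℝ) := (Real.exp_pos _).trans_le hL
  have hℓK : 6 * K ≤ Real.log (Real.log (x : ℝ)) := by rwa [Real.le_log_iff_exp_le hL0]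
  set ℓ : ℝ := Real.log (Real.log (x : ℝ)) with hℓ
  have hD : 0 ≤ |D| := abs_nonneg D
  have hS : (0 : ℝ) ≤ S := Nat.cast_nonneg S
  have hℓ1 : 1 ≤ ℓ := by linarith
  have h11 : 1 ≤ ℓ ^ 2 := by nlinarith
  have hℓℓ : ℓ ≤ ℓ ^ 2 := by nlinarith
  have hxe : (x : ℝ) = Real.exp (Real.exp ℓ) := by rw [hℓ, Real.exp_log hL0, Real.exp_log hx0]
  -- lower bound for the right-hand side
  have hrhs : Real.exp (Real.exp ℓ - (3 * ℓ + 1) * ℓ) ≤ (x : ℝ) * Real.log (x : ℝ) ^ t := by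
    rw [Real.rpow_def_of_pos hL0, ← hℓ, hxe, ← Real.exp_add, Real.exp_le_exp]
    have : ℓ * -(3 * ℓ + 1) ≤ ℓ * t := mul_le_mul_of_nonneg_left ht (by linarith)
    linarith
  -- upper bound for the left-hand side
  have hlhs : D * (3 * ℓ + 1) ^ S ≤ Real.exp (|D| + S * (3 * ℓ)) := by
    have h3 : 3 * ℓ + 1 ≤ Real.exp (3 * ℓ) := Real.add_one_le_exp _
    calc D * (3 * ℓ + 1) ^ S ≤ |D| * (3 * ℓ + 1) ^ S :=
          mul_le_mul_of_nonneg_right (le_abs_self D) (pow_nonneg (by linarith) S)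
      _ ≤ Real.exp |D| * Real.exp (3 * ℓ) ^ S :=
          mul_le_mul (by linarith [Real.add_one_le_exp |D|]) (pow_le_pow_left₀ (by linarith) h3 S)
            (pow_nonneg (by linarith) S) (Real.exp_pos _).le
      _ = Real.exp (|D| + S * (3 * ℓ)) := by rw [Real.exp_add, Real.exp_nat_mul]
  -- the key numerical inequality
  have hexp : ℓ ^ 3 / 6 ≤ Real.exp ℓ := by
    have h := Real.pow_div_factorial_le_exp ℓ (by linarith) 3
    have h3 : ((Nat.factorial 3 : ℕ) : ℝ) = 6 := by norm_num [Nat.factorial]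
    rwa [h3] at h
  have hkey : |D| + S * (3 * ℓ) ≤ Real.exp ℓ - (3 * ℓ + 1) * ℓ := by
    have i0 : K * ℓ ^ 2 ≤ ℓ ^ 3 / 6 := by
      rw [le_div_iff₀ (by norm_num : (0 : ℝ) < 6)]
      have e : ℓ ^ 3 = ℓ * ℓ ^ 2 := by ring
      rw [e]
      nlinarith
    have e : K * ℓ ^ 2 = |D| * ℓ ^ 2 + S * (3 * ℓ ^ 2) + (3 * ℓ ^ 2 + ℓ ^ 2) := by rw [hK]; ring
    have i1 : |D| ≤ |D| * ℓ ^ 2 := le_mul_of_one_le_right hD h11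
    have i2 : (S : ℝ) * (3 * ℓ) ≤ S * (3 * ℓ ^ 2) := mul_le_mul_of_nonneg_left (by linarith) hS
    have i3 : (3 * ℓ + 1) * ℓ ≤ 3 * ℓ ^ 2 + ℓ ^ 2 := by nlinarith
    linarith
  exact hlhs.trans ((Real.exp_le_exp.2 hkey).trans hrhs)

/-- Reduction, case `c = d ≥ 0`, growing disc: from the wide cell for `Σ_{m≤y} z^{g m}` on
`‖z − 1‖ ≤ 3 log log y + 3` to the bound (same `C`) for the shifted sum `Σ_{n≤x} z^{g(n+d)}` on
`‖z − 1‖ ≤ 3 log log x`. [folklore] -/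
theorem case_natCast_wide (g : ℕ → ℕ) {A₁ C₁ : ℝ} (hA : 0 ≤ A₁) (hC : 0 ≤ C₁) {x₁ : ℕ}
    (hcell : ∀ y : ℕ, x₁ ≤ y → ∀ z : ℂ, ‖z - 1‖ ≤ 3 * Real.log (Real.log (y : ℝ)) + 3 →
      ‖∑ m ∈ range (y + 1), z ^ g m‖ ≤ A₁ * (y : ℝ) * Real.log (y : ℝ) ^ (z.re - 1) *
        Real.exp (C₁ * ‖z - 1‖ * Real.log (‖z - 1‖ + 2)))
    (d : ℕ) : ∃ A : ℝ, ∃ x₀ : ℕ, ∀ x : ℕ, x₀ ≤ x → ∀ z : ℂ,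
      ‖z - 1‖ ≤ 3 * Real.log (Real.log (x : ℝ)) →
      ‖∑ n ∈ range (x + 1), z ^ g (((n : ℤ) + (d : ℤ)).toNat)‖ ≤
        A * (x : ℝ) * Real.log (x : ℝ) ^ (z.re - 1) *
          Real.exp (C₁ * ‖z - 1‖ * Real.log (‖z - 1‖ + 2)) := by
  set S : ℕ := (range d).sup g with hS
  obtain ⟨x₂, hx₂⟩ := junk_absorb (d : ℝ) S
  refine ⟨2 * Real.exp 1 * A₁ + 1, x₁ + x₂ + 4 * d + 3, fun x hx z hz => ?_⟩
  set ℓ : ℝ := Real.log (Real.log (x : ℝ)) with hℓ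
  have hxd : d ≤ x := by omega
  have hx3 : (3 : ℝ) ≤ x := by exact_mod_cast (show 3 ≤ x by omega)
  have hx0 : (0 : ℝ) < x := by linarith
  have h4dx : 4 * (d : ℝ) ≤ x := by exact_mod_cast (show 4 * d ≤ x by omega)
  have hd0 : (0 : ℝ) ≤ d := Nat.cast_nonneg d
  have hlog1 : 1 ≤ Real.log (x : ℝ) := one_le_log_of_three_le (by omega)
  have hlog0 : 0 < Real.log (x : ℝ) := by linarith
  have hℓ0 : 0 ≤ ℓ := Real.log_nonneg hlog1
  have hℓle : ℓ ≤ Real.log (x : ℝ) := (Real.log_le_sub_one_of_pos hlog0).trans (by linarith)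
  obtain ⟨ht1, ht2⟩ := re_sub_one_mem hz
  set t : ℝ := z.re - 1 with ht
  set E : ℝ := Real.exp (C₁ * ‖z - 1‖ * Real.log (‖z - 1‖ + 2)) with hE
  have hE1 : 1 ≤ E := Real.one_le_exp (mul_nonneg (mul_nonneg hC (norm_nonneg _))
    (Real.log_nonneg (by linarith [norm_nonneg (z - 1)])))
  have hLt : 0 ≤ Real.log (x : ℝ) ^ t := Real.rpow_nonneg hlog0.le t
  have hxLE : 0 ≤ (x : ℝ) * Real.log (x : ℝ) ^ t * E := by positivity
  -- the short block, absorbed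
  have hjunk : (d : ℝ) * (3 * ℓ + 1) ^ S ≤ (x : ℝ) * Real.log (x : ℝ) ^ t := hx₂ x (by omega) t ht1
  have hsmall : ‖∑ m ∈ range d, z ^ g m‖ ≤ (x : ℝ) * Real.log (x : ℝ) ^ t * E := by
    refine ((norm_sum_pow_le z g d (norm_le_of_mem_disc hz)).trans ?_).trans
      (hjunk.trans (le_mul_of_one_le_right (mul_nonneg hx0.le hLt) hE1))
    have h : ∀ m ∈ range d, (3 * ℓ + 1) ^ g m ≤ (3 * ℓ + 1) ^ S := fun m hm =>
      pow_le_pow_right₀ (by linarith) (Finset.le_sup hm)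
    calc ∑ m ∈ range d, (3 * ℓ + 1) ^ g m ≤ ∑ m ∈ range d, (3 * ℓ + 1) ^ S := Finset.sum_le_sum h
      _ = d * (3 * ℓ + 1) ^ S := by rw [Finset.sum_const, Finset.card_range, nsmul_eq_mul]
  rw [sum_shift_natCast z g x d]
  -- the long block: the wide cell at `y = x + d`
  have hxd' : ((x + d : ℕ) : ℝ) = (x : ℝ) + d := by push_cast; ring
  have hxy : (x : ℝ) ≤ (x : ℝ) + d := by linarith
  have hlogd : Real.log (x : ℝ) ≤ Real.log ((x : ℝ) + d) := Real.log_le_log hx0 hxy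
  have hℓd : ℓ ≤ Real.log (Real.log ((x : ℝ) + d)) := Real.log_le_log hlog0 hlogd
  have hzd : ‖z - 1‖ ≤ 3 * Real.log (Real.log ((x + d : ℕ) : ℝ)) + 3 := by
    rw [hxd']; linarith
  have hdiff : (Real.log (Real.log ((x : ℝ) + d)) - ℓ) * (x * Real.log x) ≤ d := by
    have := loglog_sub_mul_le (by linarith : (1 : ℝ) < x) hxy
    rwa [add_sub_cancel_left] at this
  have hcmp : Real.log ((x : ℝ) + d) ^ t ≤ Real.exp 1 * Real.log (x : ℝ) ^ t := by
    refine rpow_le_exp_mul_rpow hlog0 (hlog0.trans_le hlogd) ?_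
    have hδ0 : 0 ≤ Real.log (Real.log ((x : ℝ) + d)) - ℓ := by linarith
    have h2 : (Real.log (Real.log ((x : ℝ) + d)) - ℓ) * (4 * Real.log x) ≤ 1 := by
      refine le_of_mul_le_mul_right ?_ hx0
      calc (Real.log (Real.log ((x : ℝ) + d)) - ℓ) * (4 * Real.log x) * x
          = 4 * ((Real.log (Real.log ((x : ℝ) + d)) - ℓ) * (x * Real.log x)) := by ring
        _ ≤ 4 * d := by linarith
        _ ≤ 1 * x := by linarith
    exact (mul_le_mul_of_nonneg_left (by linarith) hδ0).trans h2
  have hbig : ‖∑ m ∈ range (x + d + 1), z ^ g m‖ ≤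
      2 * Real.exp 1 * A₁ * x * Real.log (x : ℝ) ^ t * E := by
    refine (hcell (x + d) (by omega) z hzd).trans ?_
    rw [hxd']
    calc A₁ * ((x : ℝ) + d) * Real.log ((x : ℝ) + d) ^ t * E
        = A₁ * (((x : ℝ) + d) * Real.log ((x : ℝ) + d) ^ t) * E := by ring
      _ ≤ A₁ * ((2 * x) * (Real.exp 1 * Real.log (x : ℝ) ^ t)) * E := by
          refine mul_le_mul_of_nonneg_right (mul_le_mul_of_nonneg_left ?_ hA) (by positivity)
          exact mul_le_mul (by linarith) hcmp (Real.rpow_nonneg (hlog0.le.trans hlogd) t)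
            (by positivity)
      _ = 2 * Real.exp 1 * A₁ * x * Real.log (x : ℝ) ^ t * E := by ring
  calc ‖∑ m ∈ range (x + d + 1), z ^ g m - ∑ m ∈ range d, z ^ g m‖
      ≤ ‖∑ m ∈ range (x + d + 1), z ^ g m‖ + ‖∑ m ∈ range d, z ^ g m‖ := norm_sub_le _ _
    _ ≤ 2 * Real.exp 1 * A₁ * x * Real.log (x : ℝ) ^ t * E +
          (x : ℝ) * Real.log (x : ℝ) ^ t * E := add_le_add hbig hsmall
    _ = (2 * Real.exp 1 * A₁ + 1) * x * Real.log (x : ℝ) ^ t * E := by ring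

/-- Reduction, case `c = −d ≤ 0`, growing disc: from the wide cell for `Σ_{m≤y} z^{g m}` (`g 0 = 0`)
on `‖z − 1‖ ≤ 3 log log y + 3` to the bound (same `C`) for `Σ_{n≤x} z^{g((n−d)⁺)}` on
`‖z − 1‖ ≤ 3 log log x`. [folklore] -/
theorem case_neg_wide (g : ℕ → ℕ) (hg : g 0 = 0) {A₁ C₁ : ℝ} (hA : 0 ≤ A₁) (hC : 0 ≤ C₁) {x₁ : ℕ}
    (hcell : ∀ y : ℕ, x₁ ≤ y → ∀ z : ℂ, ‖z - 1‖ ≤ 3 * Real.log (Real.log (y : ℝ)) + 3 →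
      ‖∑ m ∈ range (y + 1), z ^ g m‖ ≤ A₁ * (y : ℝ) * Real.log (y : ℝ) ^ (z.re - 1) *
        Real.exp (C₁ * ‖z - 1‖ * Real.log (‖z - 1‖ + 2)))
    (d : ℕ) : ∃ A : ℝ, ∃ x₀ : ℕ, ∀ x : ℕ, x₀ ≤ x → ∀ z : ℂ,
      ‖z - 1‖ ≤ 3 * Real.log (Real.log (x : ℝ)) →
      ‖∑ n ∈ range (x + 1), z ^ g (((n : ℤ) + -(d : ℤ)).toNat)‖ ≤
        A * (x : ℝ) * Real.log (x : ℝ) ^ (z.re - 1) *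
          Real.exp (C₁ * ‖z - 1‖ * Real.log (‖z - 1‖ + 2)) := by
  obtain ⟨x₂, hx₂⟩ := junk_absorb (d : ℝ) 0
  refine ⟨Real.exp 1 * A₁ + 1, x₁ + x₂ + 9 * d + 4, fun x hx z hz => ?_⟩
  set ℓ : ℝ := Real.log (Real.log (x : ℝ)) with hℓ
  have hxd : d ≤ x := by omega
  have hx4 : (4 : ℝ) ≤ x := by exact_mod_cast (show 4 ≤ x by omega)
  have hx0 : (0 : ℝ) < x := by linarith
  have h9dx : 9 * (d : ℝ) ≤ x := by exact_mod_cast (show 9 * d ≤ x by omega)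
  have hd0 : (0 : ℝ) ≤ d := Nat.cast_nonneg d
  have hlog1 : 1 ≤ Real.log (x : ℝ) := one_le_log_of_three_le (by omega)
  have hlog0 : 0 < Real.log (x : ℝ) := by linarith
  have hℓ0 : 0 ≤ ℓ := Real.log_nonneg hlog1
  have hℓle : ℓ ≤ Real.log (x : ℝ) := (Real.log_le_sub_one_of_pos hlog0).trans (by linarith)
  obtain ⟨ht1, ht2⟩ := re_sub_one_mem hz
  set t : ℝ := z.re - 1 with ht
  set E : ℝ := Real.exp (C₁ * ‖z - 1‖ * Real.log (‖z - 1‖ + 2)) with hE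
  have hE1 : 1 ≤ E := Real.one_le_exp (mul_nonneg (mul_nonneg hC (norm_nonneg _))
    (Real.log_nonneg (by linarith [norm_nonneg (z - 1)])))
  have hLt : 0 ≤ Real.log (x : ℝ) ^ t := Real.rpow_nonneg hlog0.le t
  -- the additive constant `d`, absorbed
  have hjunk : (d : ℝ) ≤ (x : ℝ) * Real.log (x : ℝ) ^ t := by
    simpa using hx₂ x (by omega) t ht1
  have hsmall : (d : ℝ) ≤ (x : ℝ) * Real.log (x : ℝ) ^ t * E :=
    hjunk.trans (le_mul_of_one_le_right (mul_nonneg hx0.le hLt) hE1)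
  rw [sum_shift_neg z g hg hxd]
  -- the long block: the wide cell at `y = x - d`
  have hy2 : (2 : ℝ) ≤ (x : ℝ) - d := by linarith
  have hyx : (x : ℝ) - d ≤ x := by linarith
  have hlogy : 0 < Real.log ((x : ℝ) - d) := Real.log_pos (by linarith)
  have hlogle : Real.log ((x : ℝ) - d) ≤ Real.log x := Real.log_le_log (by linarith) hyx
  have hcmp2 : Real.log (x : ℝ) ≤ 2 * Real.log ((x : ℝ) - d) := by
    have h1 : Real.log (x : ℝ) ≤ Real.log (2 * ((x : ℝ) - d)) :=
      Real.log_le_log hx0 (by linarith)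
    rw [Real.log_mul (by norm_num) (by linarith)] at h1
    have h2 : Real.log 2 ≤ Real.log ((x : ℝ) - d) := Real.log_le_log (by norm_num) hy2
    linarith
  have hδ0 : 0 ≤ ℓ - Real.log (Real.log ((x : ℝ) - d)) := by
    have := Real.log_le_log hlogy hlogle
    linarith
  have hdiff : (ℓ - Real.log (Real.log ((x : ℝ) - d))) * (((x : ℝ) - d) * Real.log ((x : ℝ) - d)) ≤
      d := by
    have := loglog_sub_mul_le (by linarith : (1 : ℝ) < (x : ℝ) - d) hyx
    rwa [sub_sub_cancel] at this
  have hkey : (ℓ - Real.log (Real.log ((x : ℝ) - d))) * (3 * ℓ + 1) ≤ 1 := by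
    have h2 : (ℓ - Real.log (Real.log ((x : ℝ) - d))) * (8 * Real.log ((x : ℝ) - d)) ≤ 1 := by
      refine le_of_mul_le_mul_right ?_ (by linarith : (0 : ℝ) < (x : ℝ) - d)
      calc (ℓ - Real.log (Real.log ((x : ℝ) - d))) * (8 * Real.log ((x : ℝ) - d)) * ((x : ℝ) - d)
          = 8 * ((ℓ - Real.log (Real.log ((x : ℝ) - d))) *
              (((x : ℝ) - d) * Real.log ((x : ℝ) - d))) := by ring
        _ ≤ 8 * d := by linarith
        _ ≤ 1 * ((x : ℝ) - d) := by linarith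
    exact (mul_le_mul_of_nonneg_left (by linarith) hδ0).trans h2
  have hδ1 : ℓ - Real.log (Real.log ((x : ℝ) - d)) ≤ 1 :=
    calc ℓ - Real.log (Real.log ((x : ℝ) - d))
        = (ℓ - Real.log (Real.log ((x : ℝ) - d))) * 1 := (mul_one _).symm
      _ ≤ (ℓ - Real.log (Real.log ((x : ℝ) - d))) * (3 * ℓ + 1) :=
          mul_le_mul_of_nonneg_left (by linarith) hδ0
      _ ≤ 1 := hkey
  have hzd : ‖z - 1‖ ≤ 3 * Real.log (Real.log ((x - d : ℕ) : ℝ)) + 3 := by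
    rw [Nat.cast_sub hxd]; linarith
  have hcmp : Real.log ((x : ℝ) - d) ^ t ≤ Real.exp 1 * Real.log (x : ℝ) ^ t := by
    refine rpow_le_exp_mul_rpow hlog0 hlogy ?_
    have : (Real.log (Real.log ((x : ℝ) - d)) - ℓ) * t ≤
        (ℓ - Real.log (Real.log ((x : ℝ) - d))) * (3 * ℓ + 1) := by nlinarith
    exact this.trans hkey
  have hbig : ‖∑ m ∈ range (x - d + 1), z ^ g m‖ ≤
      Real.exp 1 * A₁ * x * Real.log (x : ℝ) ^ t * E := by
    refine (hcell (x - d) (by omega) z hzd).trans ?_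
    rw [Nat.cast_sub hxd]
    calc A₁ * ((x : ℝ) - d) * Real.log ((x : ℝ) - d) ^ t * E
        = A₁ * (((x : ℝ) - d) * Real.log ((x : ℝ) - d) ^ t) * E := by ring
      _ ≤ A₁ * ((x : ℝ) * (Real.exp 1 * Real.log (x : ℝ) ^ t)) * E := by
          refine mul_le_mul_of_nonneg_right (mul_le_mul_of_nonneg_left ?_ hA) (by positivity)
          exact mul_le_mul hyx hcmp (Real.rpow_nonneg hlogy.le t) hx0.le
      _ = Real.exp 1 * A₁ * x * Real.log (x : ℝ) ^ t * E := by ring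
  calc ‖(d : ℂ) + ∑ m ∈ range (x - d + 1), z ^ g m‖
      ≤ ‖(d : ℂ)‖ + ‖∑ m ∈ range (x - d + 1), z ^ g m‖ := norm_add_le _ _
    _ = d + ‖∑ m ∈ range (x - d + 1), z ^ g m‖ := by rw [Complex.norm_natCast]
    _ ≤ (x : ℝ) * Real.log (x : ℝ) ^ t * E + Real.exp 1 * A₁ * x * Real.log (x : ℝ) ^ t * E :=
        add_le_add hsmall hbig
    _ = (Real.exp 1 * A₁ + 1) * x * Real.log (x : ℝ) ^ t * E := by ring

end GrowingDiscXAdd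

open FixedDiscXAdd GrowingDiscXAdd in
/-- **Calibration transport (`k = 1`, `f = X + c`, growing disc; registered stub
`stub_growingDiscXAddOfWide`).**  Assume the `f = (X)` cell on the wide growing disc
`‖z − 1‖ ≤ 3 log log y + 3`: `‖Σ_{0≤m≤y} z^{s(m)}‖ ≤ A·y·(log y)^{Re z−1}·exp(C‖z−1‖ log(‖z−1‖+2))`
for `y ≥ x₀`.  Then for every `c : ℤ` there are `A, C` and `x₀` such that for all `x ≥ x₀` and all
`z` with `‖z − 1‖ ≤ 3 log log x`:
`‖Σ_{0≤n≤x} z^{s((n+c)⁺)}‖ ≤ A·x·(log x)^{Re z − 1}·exp(C‖z−1‖ log(‖z−1‖+2))` — the body of the crux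
`DiscMajorantLog` for EVERY monic degree-1 system `(X + c)`.  Reduction: index shift `n ↦ n + c`
(`sum_shift_natCast` / `sum_shift_neg`), the disc at `x` lies in the wide disc at `x ± |c|`,
`(log(x ± |c|))^{t} ≤ e·(log x)^{t}` for `|t| ≤ 3 log log x + 1`, and the boundary terms are absorbed
by `x (log x)^t ≥ exp(e^ℓ − 3ℓ² − ℓ)` (`junk_absorb`). [cite: MontgomeryVaughan2007, §7.4 Theorems 7.17–7.18] -/
theorem stub_growingDiscXAddOfWide :
    (∃ A C : ℝ, ∃ x₀ : ℕ, ∀ x : ℕ, x₀ ≤ x → ∀ z : ℂ, ‖z - 1‖ ≤ 3 * Real.log (Real.log (x : ℝ)) + 3 →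
      ‖∑ n ∈ Finset.range (x + 1), z ^ (n.factorization.sum fun _ v => min v 2)‖ ≤
        A * (x : ℝ) * (Real.log (x : ℝ)) ^ (z.re - 1) * Real.exp (C * ‖z - 1‖ * Real.log (‖z - 1‖ + 2))) →
    ∀ c : ℤ, ∃ A C : ℝ, ∃ x₀ : ℕ, ∀ x : ℕ, x₀ ≤ x → ∀ z : ℂ, ‖z - 1‖ ≤ 3 * Real.log (Real.log (x : ℝ)) →
      ‖(∑ n ∈ Finset.range (x + 1), (z : ℂ) ^ (∑ i, ((((![Polynomial.X + Polynomial.C c] : Fin 1 → Polynomial ℤ) i).eval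
          (n : ℤ)).toNat.factorization.sum fun _ v => min v 2)))‖ ≤
        A * (x : ℝ) * (Real.log (x : ℝ)) ^ (((1 : ℕ) : ℝ) * ((z : ℂ).re - 1)) *
          Real.exp (C * ‖(z : ℂ) - 1‖ * Real.log (‖(z : ℂ) - 1‖ + 2)) := by
  rintro ⟨A₀, C₀, x₁, hW⟩ c
  have hA : (0 : ℝ) ≤ max A₀ 0 := le_max_right _ _
  have hC : (0 : ℝ) ≤ max C₀ 0 := le_max_right _ _
  have hcell : ∀ y : ℕ, x₁ ≤ y → ∀ z : ℂ, ‖z - 1‖ ≤ 3 * Real.log (Real.log (y : ℝ)) + 3 →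
      ‖∑ m ∈ range (y + 1), z ^ (m.factorization.sum fun _ v => min v 2)‖ ≤
        max A₀ 0 * (y : ℝ) * Real.log (y : ℝ) ^ (z.re - 1) *
          Real.exp (max C₀ 0 * ‖z - 1‖ * Real.log (‖z - 1‖ + 2)) := fun y hy z hz =>
    (hW y hy z hz).trans (budget_mono (le_max_left _ _) hA (le_max_left _ _) y z)
  obtain ⟨d, rfl | rfl⟩ := Int.eq_nat_or_neg c
  · obtain ⟨A, x₀, h⟩ :=
      case_natCast_wide (fun m => m.factorization.sum fun _ v => min v 2) hA hC hcell d
    refine ⟨A, max C₀ 0, x₀, fun x hx z hz => ?_⟩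
    simp_rw [exponent_XAdd, Nat.cast_one, one_mul]
    exact h x hx z hz
  · obtain ⟨A, x₀, h⟩ :=
      case_neg_wide (fun m => m.factorization.sum fun _ v => min v 2) (by simp) hA hC hcell d
    refine ⟨A, max C₀ 0, x₀, fun x hx z hz => ?_⟩
    simp_rw [exponent_XAdd, Nat.cast_one, one_mul]
    exact h x hx z hz

end Summit.Parity.BatemanHorn.Cruxes.DiscMajorantLog.Sketch

end
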